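import Literature.NumberTheory.LFunctions.ExceptionalPrimesHyperbola
import HarnessLib

/-!
# The hyperbola method for `∑_{n ≤ X} (1∗χ)(n) n^{−β}` at a point where `L(β, χ) ≥ 0`:
# a one-sided upper bound (the input of the explicit Hecke lemma)

Topic `Literature/NumberTheory/LFunctions`. Everything in this file is PROVED (theorems only; no
definition, no named fact). Companion of the tree's `ExceptionalPrimesHyperbola.lean`
(`SiegelZero.abs_sum_re_zetaMul_mul_rpow_sub_main_le`: the same sum evaluated AT a real zero `β` of
`L(s, χ)`, two-sided). Here `β ∈ (0, 1)` is any point with `Re L(β, χ) ≥ 0` (e.g. no zero of the real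
`L(s, χ)` on `[β, 1]`), and only the UPPER bound survives — which is all Hecke's lemma needs:

* `norm_sum_Icc_mul_rpow_sub_LFunction_le` / `abs_sum_Icc_re_mul_rpow_sub_LFunction_re_le` —
  `|∑_{n ≤ N} χ(n) n^{−σ} − L(σ, χ)| ≤ 2q (N+1)^{−σ}` (`σ > 0`, `χ ≠ χ₀`; finite Abel summation and
  `∑_{n ≤ M} χ(n) n^{−σ} → L(σ, χ)`, the tree's `SiegelZero.tendsto_sum_Icc_mul_cpow`);
* `sum_re_zetaMul_mul_rpow_sub_main_le_of_nonneg` — for a quadratic `χ ≠ χ₀` mod `q`, `0 < β < 1`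
  with `Re L(β, χ) ≥ 0`, `X ≥ 1`, `D = ⌊√X⌋`, `A(D) = ∑_{e ≤ D} e^{−β}`:
  **`∑_{n ≤ X} (1∗χ)(n) n^{−β} − (X^{1−β}/(1−β)) ∑_{d ≤ D} χ(d)/d ≤ 2 D^{−β}((q+1) A(D) + q/(1−β))`**
  (the cross term `(A(D) − D^{1−β}/(1−β)) · ∑_{d ≤ D} χ(d) d^{−β}` has first factor in
  `[−1/(1−β), 0]` and second factor `≥ Re L(β,χ) − 2q(D+1)^{−β} ≥ −2q D^{−β}`).

Used by `HeckeLOneLowerBoundExplicit.lean` (`L(1, χ) ≥ 1/(12 log q)` when `L(s, χ)` has no zero on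
`[1 − 1/(4 log q), 1]`). LABEL: instrument (kernel). WHAT THIS IS NOT: no lower bound for the sum beyond
the trivial `≥ 1` (`SiegelZero.one_le_sum_zetaMul_rpow`) is proved here.

## References

* H. L. Montgomery, R. C. Vaughan, *Multiplicative Number Theory I*, CUP 2007, §2.1 (hyperbola method),
  §1.3 Thm. 1.3 and §4.3 (4.23) (Abel summation, `|S(N)| ≤ q`), §11.2 Thm. 11.14 (Case A).
  [MontgomeryVaughan2007]
* T. Tao, J. Teräväinen, J. London Math. Soc. 106 (2022), §3.3 (the evaluation reused). [TaoTeravainen2021]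
-/

noncomputable section

open Complex Filter Topology Finset
open Literature.NumberTheory.LFunctions.DirichletAbel
open Literature.NumberTheory.LFunctions.SiegelZero

namespace Literature.NumberTheory.LFunctions.Hecke

variable {q : ℕ} [NeZero q] (χ : DirichletCharacter ℂ q)

/-! ### Partial sums of `∑ χ(n) n^{−σ}` against `L(σ, χ)` -/

/-- **Partial sums vs the value, `Re s = σ > 0`**: for `χ ≠ χ₀` mod `q`,
`‖∑_{n ≤ N} χ(n) n^{−σ} − L(σ, χ)‖ ≤ 2q (N+1)^{−σ}` (`∑_{n ≤ M} → L(σ,χ)` and the finite Abel bound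
on the windows). [cite: MontgomeryVaughan2007, §1.3 Thm. 1.3 with §4.3 eq. (4.23)] -/
theorem norm_sum_Icc_mul_rpow_sub_LFunction_le (hχ : χ ≠ 1) {σ : ℝ} (hσ : 0 < σ) (N : ℕ) :
    ‖∑ n ∈ Icc 1 N, χ (n : ZMod q) * (((n : ℝ) ^ (-σ) : ℝ) : ℂ) - χ.LFunction σ‖ ≤
      2 * q * ((N + 1 : ℕ) : ℝ) ^ (-σ) := by
  set P : ℕ → ℂ := fun M => ∑ n ∈ Icc 1 M, χ (n : ZMod q) * (((n : ℝ) ^ (-σ) : ℝ) : ℂ) with hP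
  have hlim : Tendsto P atTop (𝓝 (χ.LFunction σ)) := by
    have h := tendsto_sum_Icc_mul_cpow χ hχ (s := σ) (by simpa using hσ)
    refine h.congr fun M => Finset.sum_congr rfl fun n _ => ?_
    rw [Complex.ofReal_cpow (Nat.cast_nonneg n), Complex.ofReal_natCast, Complex.ofReal_neg]
  have hwin : ∀ M, N ≤ M → ‖P M - P N‖ ≤ 2 * q * ((N + 1 : ℕ) : ℝ) ^ (-σ) := by
    intro M hNM
    have hsplit : P M - P N = ∑ n ∈ Ioc N M, χ (n : ZMod q) * (((n : ℝ) ^ (-σ) : ℝ) : ℂ) := by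
      have hI : ∀ K : ℕ, Finset.Icc 1 K = Finset.Ioc 0 K := fun K => by
        ext n; simp only [Finset.mem_Icc, Finset.mem_Ioc]; omega
      simp only [hP]
      rw [hI, hI, ← Finset.sum_Ioc_consecutive _ (Nat.zero_le N) hNM, add_sub_cancel_left]
    rw [hsplit]
    have h := norm_sum_Ioc_mul_le χ hχ (a := fun n : ℕ => (n : ℝ) ^ (-σ)) (N := N)
      (fun n _ => by positivity) (fun n hn => ?_) M
    · simpa using h
    · have hn0 : (0 : ℝ) < n := by exact_mod_cast (Nat.zero_le N).trans_lt hn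
      push_cast
      exact Real.rpow_le_rpow_of_nonpos hn0 (by linarith) (by linarith)
  have hnorm : Tendsto (fun M => ‖P M - P N‖) atTop (𝓝 ‖χ.LFunction σ - P N‖) :=
    (tendsto_norm.comp (hlim.sub tendsto_const_nhds))
  have hle := le_of_tendsto hnorm (Filter.eventually_atTop.mpr ⟨N, hwin⟩)
  rwa [norm_sub_rev] at hle

/-- Real form for a quadratic character: `|∑_{n ≤ N} χ(n) n^{−σ} − Re L(σ, χ)| ≤ 2q (N+1)^{−σ}`.
[cite: MontgomeryVaughan2007, §1.3 Thm. 1.3 with §4.3 eq. (4.23)] -/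
theorem abs_sum_Icc_re_mul_rpow_sub_LFunction_re_le (hχ : χ ≠ 1) (hq : χ ^ 2 = 1) {σ : ℝ}
    (hσ : 0 < σ) (N : ℕ) :
    |∑ n ∈ Icc 1 N, (χ (n : ZMod q)).re * (n : ℝ) ^ (-σ) - (χ.LFunction σ).re| ≤
      2 * q * ((N + 1 : ℕ) : ℝ) ^ (-σ) := by
  have h := norm_sum_Icc_mul_rpow_sub_LFunction_le χ hχ hσ N
  rw [sum_mul_ofReal_eq χ hq] at h
  have hre := Complex.abs_re_le_norm
    (((∑ n ∈ Icc 1 N, (χ (n : ZMod q)).re * (n : ℝ) ^ (-σ) : ℝ) : ℂ) - χ.LFunction σ)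
  rw [Complex.sub_re, Complex.ofReal_re] at hre
  exact hre.trans h

/-! ### The hyperbola method at a point where `L(β, χ) ≥ 0` -/

/-- **One-sided hyperbola estimate**: for a quadratic `χ ≠ χ₀` mod `q`, `0 < β < 1` with
`Re L(β, χ) ≥ 0`, and an integer `X ≥ 1` with `D = ⌊√X⌋`, `A(D) = ∑_{e ≤ D} e^{−β}`:
`∑_{n ≤ X} (1∗χ)(n) n^{−β} − (X^{1−β}/(1−β)) ∑_{d ≤ D} χ(d)/d ≤ 2 D^{−β}((q+1) A(D) + q/(1−β))`.
Same bookkeeping as the tree's `SiegelZero.abs_sum_re_zetaMul_mul_rpow_sub_main_le` (there at a zero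
`β`, two-sided); the cross term is now `(A(D) − D^{1−β}/(1−β)) · ∑_{d≤D} χ(d)d^{−β}` with the first
factor in `[−1/(1−β), 0]` and the second `≥ Re L(β,χ) − 2q(D+1)^{−β}`.
[cite: MontgomeryVaughan2007, §11.2 Thm. 11.14 (Case A) and §2.1] [cite: TaoTeravainen2021, §3.3] -/
theorem sum_re_zetaMul_mul_rpow_sub_main_le_of_nonneg (hχ : χ ≠ 1) (hq : χ ^ 2 = 1) {β : ℝ}
    (hβ0 : 0 < β) (hβ1 : β < 1) (hpos : 0 ≤ (χ.LFunction β).re) {X : ℕ} (hX : 1 ≤ X) :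
    ∑ n ∈ Icc 1 X, (χ.zetaMul n).re * (n : ℝ) ^ (-β) -
        (X : ℝ) ^ (1 - β) / (1 - β) * ∑ d ∈ Icc 1 (Nat.sqrt X), (χ (d : ZMod q)).re / d ≤
      2 * ((Nat.sqrt X : ℕ) : ℝ) ^ (-β) *
        ((q + 1) * ∑ e ∈ Icc 1 (Nat.sqrt X), (e : ℝ) ^ (-β) + q / (1 - β)) := by
  set D : ℕ := Nat.sqrt X with hDdef
  set A : ℕ → ℝ := fun K => ∑ e ∈ Icc 1 K, (e : ℝ) ^ (-β) with hAdef
  set χr : ℕ → ℝ := fun d => (χ (d : ZMod q)).re with hχrdef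
  have hκ : 0 < 1 - β := by linarith
  have hD1 : 1 ≤ D := Nat.le_sqrt.mpr (by simpa using hX)
  have hDX : D ≤ X := Nat.sqrt_le_self X
  have hD0 : (0 : ℝ) < D := by exact_mod_cast hD1
  have hχr1 : ∀ d : ℕ, |χr d| ≤ 1 := fun d =>
    (Complex.abs_re_le_norm _).trans (χ.norm_le_one _)
  have hA0 : ∀ K, 0 ≤ A K := fun K => sum_Icc_rpow_nonneg β K
  have hI : ∀ K : ℕ, Finset.Icc 1 K = Finset.Ioc 0 K := fun K => by
    ext n; simp only [Finset.mem_Icc, Finset.mem_Ioc]; omega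
  -- Step 1: hyperbola identity and the split at `D`
  have hG : ∑ n ∈ Icc 1 X, (χ.zetaMul n).re * (n : ℝ) ^ (-β) =
      ∑ d ∈ Icc 1 D, χr d * (d : ℝ) ^ (-β) * A (X / d) +
        ∑ d ∈ Ioc D X, χr d * (d : ℝ) ^ (-β) * A (X / d) := by
    rw [sum_re_zetaMul_mul_rpow_eq χ β X, hI X, hI D,
      Finset.sum_Ioc_consecutive _ (Nat.zero_le D) hDX]
  -- Step 2: the tail
  have htail : |∑ d ∈ Ioc D X, χr d * (d : ℝ) ^ (-β) * A (X / d)| ≤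
      2 * q * ((D : ℝ) ^ (-β) * A D) := by
    have h := abs_sum_Ioc_re_mul_rpow_mul_sum_le χ hχ hq hβ0.le X D X
    have e : ∑ d ∈ Ioc D X, χr d * (d : ℝ) ^ (-β) * A (X / d) =
        ∑ d ∈ Ioc D X, χr d * ((d : ℝ) ^ (-β) * A (X / d)) :=
      Finset.sum_congr rfl fun d _ => by ring
    rw [e]
    refine h.trans ?_
    have h1 : ((D + 1 : ℕ) : ℝ) ^ (-β) ≤ (D : ℝ) ^ (-β) :=
      Real.rpow_le_rpow_of_nonpos hD0 (by push_cast; linarith) (by linarith)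
    have hXD : X / (D + 1) ≤ D := by
      have hlt : X < (D + 1) * (D + 1) := Nat.lt_succ_sqrt X
      exact Nat.le_of_lt_succ ((Nat.div_lt_iff_lt_mul (Nat.succ_pos D)).mpr hlt)
    have h2 : A (X / (D + 1)) ≤ A D := sum_Icc_rpow_mono β hXD
    have hq0 : (0 : ℝ) ≤ 2 * q := by positivity
    exact mul_le_mul_of_nonneg_left
      (mul_le_mul h1 h2 (hA0 _) (Real.rpow_nonneg hD0.le _)) hq0
  -- Step 3: the head, decomposed
  have hhead : ∑ d ∈ Icc 1 D, χr d * (d : ℝ) ^ (-β) * A (X / d) =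
      (A D - (D : ℝ) ^ (1 - β) / (1 - β)) * ∑ d ∈ Icc 1 D, χr d * (d : ℝ) ^ (-β) +
      (X : ℝ) ^ (1 - β) / (1 - β) * ∑ d ∈ Icc 1 D, χr d / d -
      ∑ d ∈ Icc 1 D, χr d * (d : ℝ) ^ (-β) *
        (A D + (((X : ℝ) / d) ^ (1 - β) - (D : ℝ) ^ (1 - β)) / (1 - β) - A (X / d)) := by
    rw [Finset.mul_sum, Finset.mul_sum, ← Finset.sum_add_distrib, ← Finset.sum_sub_distrib]
    refine Finset.sum_congr rfl fun d hd => ?_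
    have hd1 : (0 : ℝ) < d := by exact_mod_cast (Finset.mem_Icc.mp hd).1
    have hX0 : (0 : ℝ) ≤ X := Nat.cast_nonneg X
    have key : (d : ℝ) ^ (-β) * ((X : ℝ) / d) ^ (1 - β) = (X : ℝ) ^ (1 - β) / d := by
      rw [Real.div_rpow hX0 hd1.le]
      have hdd : (d : ℝ) ^ (-β) / (d : ℝ) ^ (1 - β) = 1 / d := by
        rw [← Real.rpow_sub hd1, show -β - (1 - β) = -1 by ring, Real.rpow_neg_one, one_div]
      calc (d : ℝ) ^ (-β) * ((X : ℝ) ^ (1 - β) / (d : ℝ) ^ (1 - β))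
          = (X : ℝ) ^ (1 - β) * ((d : ℝ) ^ (-β) / (d : ℝ) ^ (1 - β)) := by ring
        _ = (X : ℝ) ^ (1 - β) / d := by rw [hdd]; ring
    linear_combination (χr d / (1 - β)) * key
  -- Step 4: bounds for the three head pieces (the cross term one-sided)
  have hsumL : |∑ d ∈ Icc 1 D, χr d * (d : ℝ) ^ (-β) - (χ.LFunction β).re| ≤
      2 * q * (D : ℝ) ^ (-β) := by
    refine (abs_sum_Icc_re_mul_rpow_sub_LFunction_re_le χ hχ hq hβ0 D).trans ?_
    have h1 : ((D + 1 : ℕ) : ℝ) ^ (-β) ≤ (D : ℝ) ^ (-β) :=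
      Real.rpow_le_rpow_of_nonpos hD0 (by push_cast; linarith) (by linarith)
    exact mul_le_mul_of_nonneg_left h1 (by positivity)
  have hADle : A D - (D : ℝ) ^ (1 - β) / (1 - β) ≤ 0 := by
    have h := sum_Icc_rpow_le hβ0.le hβ1 hD1
    have e : 1 + ((D : ℝ) ^ (1 - β) - 1) / (1 - β) =
        (D : ℝ) ^ (1 - β) / (1 - β) - β / (1 - β) := by field_simp; ring
    have hb : 0 ≤ β / (1 - β) := div_nonneg hβ0.le hκ.le
    change A D ≤ _ at h
    linarith
  have hADabs : |A D - (D : ℝ) ^ (1 - β) / (1 - β)| ≤ 1 / (1 - β) :=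
    abs_sum_Icc_rpow_sub_le hβ0.le hβ1 hD1
  have hprod : (A D - (D : ℝ) ^ (1 - β) / (1 - β)) * ∑ d ∈ Icc 1 D, χr d * (d : ℝ) ^ (-β) ≤
      1 / (1 - β) * (2 * q * (D : ℝ) ^ (-β)) := by
    set c₀ := A D - (D : ℝ) ^ (1 - β) / (1 - β) with hc₀
    set P := ∑ d ∈ Icc 1 D, χr d * (d : ℝ) ^ (-β) with hP
    set Lr := (χ.LFunction β).re with hLr
    -- `c₀ P = c₀ Lr + c₀ (P − Lr) ≤ 0 + |c₀| |P − Lr|`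
    have h1 : c₀ * Lr ≤ 0 := mul_nonpos_of_nonpos_of_nonneg hADle hpos
    have h2 : c₀ * (P - Lr) ≤ |c₀| * |P - Lr| := by
      rw [← abs_mul]; exact le_abs_self _
    have h3 : |c₀| * |P - Lr| ≤ 1 / (1 - β) * (2 * q * (D : ℝ) ^ (-β)) :=
      mul_le_mul hADabs hsumL (abs_nonneg _) (by positivity)
    nlinarith
  have hΨ : |∑ d ∈ Icc 1 D, χr d * (d : ℝ) ^ (-β) *
      (A D + (((X : ℝ) / d) ^ (1 - β) - (D : ℝ) ^ (1 - β)) / (1 - β) - A (X / d))| ≤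
      2 * (D : ℝ) ^ (-β) * A D := by
    refine (Finset.abs_sum_le_sum_abs _ _).trans ?_
    have hbound : ∀ d ∈ Icc 1 D, |χr d * (d : ℝ) ^ (-β) *
        (A D + (((X : ℝ) / d) ^ (1 - β) - (D : ℝ) ^ (1 - β)) / (1 - β) - A (X / d))| ≤
        (d : ℝ) ^ (-β) * (2 * (D : ℝ) ^ (-β)) := by
      intro d hd
      obtain ⟨hd1, hdD⟩ := Finset.mem_Icc.mp hd
      have hDd : D ≤ X / d := by
        rw [Nat.le_div_iff_mul_le hd1]
        exact (Nat.mul_le_mul_left D hdD).trans (Nat.sqrt_le X)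
      obtain ⟨hψ0, hψ2⟩ := head_term_bounds (X := X) hβ0.le hβ1 hd1 hD1 hDd
      have hdβ : 0 ≤ (d : ℝ) ^ (-β) := Real.rpow_nonneg (Nat.cast_nonneg d) _
      rw [abs_mul, abs_mul, abs_of_nonneg hdβ, abs_of_nonneg hψ0]
      calc |χr d| * (d : ℝ) ^ (-β) *
            (A D + (((X : ℝ) / d) ^ (1 - β) - (D : ℝ) ^ (1 - β)) / (1 - β) - A (X / d))
          ≤ 1 * (d : ℝ) ^ (-β) * (2 * (D : ℝ) ^ (-β)) := by
            gcongr
            exact hχr1 d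
        _ = (d : ℝ) ^ (-β) * (2 * (D : ℝ) ^ (-β)) := by ring
    refine (Finset.sum_le_sum hbound).trans (le_of_eq ?_)
    rw [← Finset.sum_mul]
    ring
  -- Step 5: assemble (one-sided)
  have hmainId : ∑ n ∈ Icc 1 X, (χ.zetaMul n).re * (n : ℝ) ^ (-β) -
      (X : ℝ) ^ (1 - β) / (1 - β) * ∑ d ∈ Icc 1 D, χr d / d =
      ∑ d ∈ Ioc D X, χr d * (d : ℝ) ^ (-β) * A (X / d) +
      (A D - (D : ℝ) ^ (1 - β) / (1 - β)) * ∑ d ∈ Icc 1 D, χr d * (d : ℝ) ^ (-β) -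
      ∑ d ∈ Icc 1 D, χr d * (d : ℝ) ^ (-β) *
        (A D + (((X : ℝ) / d) ^ (1 - β) - (D : ℝ) ^ (1 - β)) / (1 - β) - A (X / d)) := by
    rw [hG, hhead]; ring
  rw [hmainId]
  have ht := (abs_le.mp htail).2
  have hΨ' := (abs_le.mp hΨ).1
  have hfin : 2 * q * ((D : ℝ) ^ (-β) * A D) + 1 / (1 - β) * (2 * q * (D : ℝ) ^ (-β)) +
      2 * (D : ℝ) ^ (-β) * A D = 2 * (D : ℝ) ^ (-β) * ((q + 1) * A D + q / (1 - β)) := by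
    field_simp
    ring
  linarith

end Literature.NumberTheory.LFunctions.Hecke
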